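import Mathlib
import HarnessLib

/-!
# Bernstein's inequality for sums of independent bounded random variables:
# `P(Σ_{j<R}(X_j − E X_j) ≥ t) ≤ exp(−t²/(2(Rσ² + bt/3)))`, `P(|R⁻¹Σ_{j<R} X_j − m| ≥ ε) ≤ 2·exp(−Rε²/(2(σ² + bε/3)))`

HONEST FRAMING: exact (Metropolis-corrected) sampling algorithms for lattice gauge theory;
figures of merit are autocorrelation/cost numbers at stated couplings and volumes; no
continuum-physics claim.

Venture `LatticeQCDFlow` (cell pub-lqcd), topic `Exactness`; FANOUT row 30 (lean-1, GEN-40).  NEW WORK of the cell (generic probability,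
self-contained; Mathlib has Hoeffding's inequality `HasSubgaussianMGF.measure_sum_range_ge_le_of_iIndepFun` but NO Bernstein inequality).
The variance-sensitive exponential inequality that the coupled-estimator files asked for (GEN-39 `Exactness/IMHCoupledEstimatorHoeffding`,
`…BurnInHoeffding`: «NOT CLAIMED: a variance-sensitive (Bernstein) exponent»); its application to the coupled flow-MCMC estimator is the
sequel `Exactness/IMHCoupledEstimatorBernstein`.  Chernoff's method with the exponential-series bound:

* §1 (analytic, [ours]) **`two_mul_three_pow_le_factorial`** (`2·3ⁿ ≤ (n + 2)!`); **`exp_sub_one_sub_le_of_nonneg`** — `0 ≤ t < 3 ⇒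
  e^t − 1 − t ≤ t²/(2(1 − t/3))` (Mathlib's exponential series `NormedSpace.expSeries_div_hasSum_exp`, termwise `tⁿ⁺²/(n + 2)! ≤ (t²/2)(t/3)ⁿ`,
  geometric sum); **`exp_sub_one_sub_le_of_abs_le`** — `|u| ≤ s < 3 ⇒ e^u − 1 − u ≤ u²/(2(1 − s/3))` (`sinh u ≤ u` for `u ≤ 0`).
* §2 (probabilistic, [ours]) **`variance_le_integral_sub_sq`** (`Var X ≤ E(X − θ)²`, bookkeeping); **`bernstein_mgf_le`** — `Y` measurable, `E Y = 0`, `|Y| ≤ b`, `E Y² ≤ v`, `0 ≤ λ`, `λb < 3` ⇒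
  `E e^{λY} ≤ exp(λ²v/(2(1 − λb/3)))`; **`bernstein_sum_ge`** — BERNSTEIN'S INEQUALITY (S. N. Bernstein 1924; the form of
  Boucheron–Lugosi–Massart, *Concentration Inequalities*, Cor. 2.11 — named only, proved here): mutually independent measurable `X_j` with
  `|X_j − E X_j| ≤ b`, `Var X_j ≤ σ²` (`σ² > 0`), `t ≥ 0`, `R ≥ 1` ⇒ `P(Σ_{j<R}(X_j − E X_j) ≥ t) ≤ exp(−t²/(2(Rσ² + bt/3)))`
  (`λ = t/(Rσ² + bt/3)`; Mathlib's `iIndepFun.mgf_sum` and Chernoff bound `measure_ge_le_exp_mul_mgf` APPLIED); for a common mean `m`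
  the average forms **`bernstein_avg_ge`**, **`bernstein_avg_le`**, **`bernstein_avg_abs`** —
  `P(|R⁻¹Σ_{j<R} X_j − m| ≥ ε) ≤ 2·exp(−Rε²/(2(σ² + bε/3)))` (`ε ≥ 0`).
Comparison: Hoeffding's exponent for `X_j ∈ [a, c]` is `2Rε²/(c − a)²`; since `Var X_j ≤ (c − a)²/4` (Popoviciu) Bernstein's
`Rε²/(2(σ² + (c − a)ε/3))` is never worse by more than the factor `1 + 4ε/(3(c − a))` and is better by `(c − a)²/(4σ²)` as `ε → 0`.
NOT CLAIMED: Bennett's `h`-form; the moment (unbounded) version; martingale ∕ empirical-variance versions.  No `sorry`, no new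
definitions, nothing cited as a fact.
-/

noncomputable section

namespace Summit.Ventures.LatticeQCDFlow.Exactness

open MeasureTheory ProbabilityTheory Function Finset Filter
open scoped ENNReal unitInterval Topology NNReal

/-! ## §1 The exponential-series bound -/

section Analytic

/-- `2·3ⁿ ≤ (n + 2)!`. [ours, bookkeeping] -/
theorem two_mul_three_pow_le_factorial (n : ℕ) : 2 * 3 ^ n ≤ (n + 2).factorial := by
  induction n with
  | zero => simp [Nat.factorial]
  | succ n ih =>
    rw [show n + 1 + 2 = (n + 2) + 1 from by ring, Nat.factorial_succ, pow_succ]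
    calc 2 * (3 ^ n * 3) = 3 * (2 * 3 ^ n) := by ring
      _ ≤ (n + 2 + 1) * (n + 2).factorial := Nat.mul_le_mul (by omega) ih

/-- **The exponential-series bound**: for `0 ≤ t < 3`, `e^t − 1 − t ≤ t²/(2(1 − t/3))` (termwise `tⁿ⁺²/(n + 2)! ≤ (t²/2)(t/3)ⁿ`).
[ours — Mathlib's exponential series applied] -/
theorem exp_sub_one_sub_le_of_nonneg {t : ℝ} (ht0 : 0 ≤ t) (ht3 : t < 3) :
    Real.exp t - 1 - t ≤ t ^ 2 / (2 * (1 - t / 3)) := by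
  have hsum : HasSum (fun n : ℕ => t ^ n / n.factorial) (Real.exp t) := by
    have h := NormedSpace.expSeries_div_hasSum_exp (𝔸 := ℝ) t
    rwa [← congrFun Real.exp_eq_exp_ℝ t] at h
  have hsum2 : HasSum (fun n : ℕ => t ^ (n + 2) / (n + 2).factorial) (Real.exp t - 1 - t) := by
    have h := (hasSum_nat_add_iff' 2).2 hsum
    have h2 : ∑ i ∈ range 2, t ^ i / (i.factorial : ℝ) = 1 + t := by
      simp [sum_range_succ]
    rw [h2, ← sub_sub] at h
    exact_mod_cast h
  have hgeom : HasSum (fun n : ℕ => t ^ 2 / 2 * (t / 3) ^ n) (t ^ 2 / 2 * (1 - t / 3)⁻¹) :=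
    (hasSum_geometric_of_lt_one (by positivity) (by linarith)).mul_left (t ^ 2 / 2)
  have hle : ∀ n, t ^ (n + 2) / ((n + 2).factorial : ℝ) ≤ t ^ 2 / 2 * (t / 3) ^ n := by
    intro n
    rw [div_pow, pow_add, show t ^ 2 / 2 * (t ^ n / 3 ^ n) = t ^ n * t ^ 2 / (2 * 3 ^ n) by ring]
    apply div_le_div_of_nonneg_left (by positivity) (by positivity)
    exact_mod_cast two_mul_three_pow_le_factorial n
  have hne : (1 - t / 3) ≠ 0 := by
    have : 0 < 1 - t / 3 := by linarith
    exact this.ne'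
  calc Real.exp t - 1 - t ≤ t ^ 2 / 2 * (1 - t / 3)⁻¹ := hasSum_le hle hsum2 hgeom
    _ = t ^ 2 / (2 * (1 - t / 3)) := by rw [← div_div, div_eq_mul_inv (t ^ 2 / 2)]

/-- For `|u| ≤ s < 3`: `e^u − 1 − u ≤ u²/(2(1 − s/3))` (the odd terms only help for `u < 0`: `sinh u ≤ u`). [ours] -/
theorem exp_sub_one_sub_le_of_abs_le {u s : ℝ} (hus : |u| ≤ s) (hs3 : s < 3) :
    Real.exp u - 1 - u ≤ u ^ 2 / (2 * (1 - s / 3)) := by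
  have hu3 : |u| < 3 := hus.trans_lt hs3
  have h1 : Real.exp u - 1 - u ≤ Real.exp |u| - 1 - |u| := by
    rcases le_or_gt 0 u with hu | hu
    · rw [abs_of_nonneg hu]
    · rw [abs_of_neg hu]
      have h := Real.sinh_lt_self_iff.2 hu
      rw [Real.sinh_eq] at h
      linarith
  have h2 := exp_sub_one_sub_le_of_nonneg (abs_nonneg u) hu3
  rw [sq_abs] at h2
  have h3 : u ^ 2 / (2 * (1 - |u| / 3)) ≤ u ^ 2 / (2 * (1 - s / 3)) :=
    div_le_div_of_nonneg_left (sq_nonneg u) (by linarith) (by linarith)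
  linarith

end Analytic

/-! ## §2 Bernstein's inequality -/

section Generic

variable {Ω' : Type*} {mΩ' : MeasurableSpace Ω'} {μ : Measure Ω'} [IsProbabilityMeasure μ]

/-- `Var X ≤ E(X − θ)²` for every constant `θ` (`X` square integrable): `E(X − θ)² = Var X + (E X − θ)²`. [ours, bookkeeping] -/
theorem variance_le_integral_sub_sq {Y : Ω' → ℝ} (hY : MemLp Y 2 μ) (θ : ℝ) :
    variance Y μ ≤ ∫ ω, (Y ω - θ) ^ 2 ∂μ := by
  have hYi : Integrable Y μ := hY.integrable one_le_two
  have hY2i : Integrable (fun ω => Y ω ^ 2) μ := hY.integrable_sq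
  have hexp : ∫ ω, (Y ω - θ) ^ 2 ∂μ = ∫ ω, Y ω ^ 2 ∂μ - 2 * θ * ∫ ω, Y ω ∂μ + θ ^ 2 := by
    have h1 : (fun ω => (Y ω - θ) ^ 2) = fun ω => (Y ω ^ 2 - 2 * θ * Y ω) + θ ^ 2 := funext fun ω => by ring
    have i2 : Integrable (fun ω => 2 * θ * Y ω) μ := hYi.const_mul _
    have i1 : Integrable (fun ω => Y ω ^ 2 - 2 * θ * Y ω) μ := hY2i.sub i2
    rw [h1, integral_add i1 (integrable_const _), integral_sub hY2i i2, integral_const_mul]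
    simp
  rw [variance_eq_sub hY, hexp]
  have : (∫ ω, Y ω ∂μ - θ) ^ 2 ≥ 0 := sq_nonneg _
  have hp : μ[Y ^ 2] = ∫ ω, Y ω ^ 2 ∂μ := rfl
  rw [hp]
  nlinarith

/-- **THE BERNSTEIN MGF BOUND FOR ONE VARIABLE**: `Y` measurable, centred (`E Y = 0`), `|Y| ≤ b`, `E Y² ≤ v`; for `0 ≤ λ` with `λb < 3`,
`E e^{λY} ≤ exp(λ²v/(2(1 − λb/3)))`. [ours] -/
theorem bernstein_mgf_le {Y : Ω' → ℝ} (hYm : Measurable Y) {b : ℝ} (hb : ∀ ω, |Y ω| ≤ b) (hY0 : μ[Y] = 0)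
    {v : ℝ} (hv : ∫ ω, Y ω ^ 2 ∂μ ≤ v) {t : ℝ} (ht : 0 ≤ t) (htb : t * b < 3) :
    mgf Y μ t ≤ Real.exp (t ^ 2 * v / (2 * (1 - t * b / 3))) := by
  have hden : 0 < 1 - t * b / 3 := by linarith
  have hYi : Integrable Y μ :=
    Integrable.of_bound hYm.aestronglyMeasurable b (ae_of_all _ fun ω => by rw [Real.norm_eq_abs]; exact hb ω)
  have hY2i : Integrable (fun ω => Y ω ^ 2) μ :=
    Integrable.of_bound (hYm.pow_const 2).aestronglyMeasurable (b ^ 2) (ae_of_all _ fun ω => by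
      rw [Real.norm_eq_abs, abs_pow]; exact pow_le_pow_left₀ (abs_nonneg _) (hb ω) 2)
  have hexpi : Integrable (fun ω => Real.exp (t * Y ω)) μ :=
    Integrable.of_bound ((hYm.const_mul t).exp).aestronglyMeasurable (Real.exp (t * b)) (ae_of_all _ fun ω => by
      rw [Real.norm_eq_abs, abs_of_pos (Real.exp_pos _), Real.exp_le_exp]
      calc t * Y ω ≤ t * |Y ω| := mul_le_mul_of_nonneg_left (le_abs_self _) ht
        _ ≤ t * b := mul_le_mul_of_nonneg_left (hb ω) ht)
  have hpt : ∀ ω, Real.exp (t * Y ω) ≤ 1 + t * Y ω + t ^ 2 / (2 * (1 - t * b / 3)) * Y ω ^ 2 := by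
    intro ω
    have habs : |t * Y ω| ≤ t * b := by
      rw [abs_mul, abs_of_nonneg ht]; exact mul_le_mul_of_nonneg_left (hb ω) ht
    have h := exp_sub_one_sub_le_of_abs_le habs htb
    have hre : (t * Y ω) ^ 2 / (2 * (1 - t * b / 3)) = t ^ 2 / (2 * (1 - t * b / 3)) * Y ω ^ 2 := by ring
    linarith
  have i3 : Integrable (fun ω => t * Y ω) μ := hYi.const_mul t
  have i1 : Integrable (fun ω => 1 + t * Y ω) μ := (integrable_const 1).add i3
  have i2 : Integrable (fun ω => t ^ 2 / (2 * (1 - t * b / 3)) * Y ω ^ 2) μ := hY2i.const_mul _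
  calc mgf Y μ t = ∫ ω, Real.exp (t * Y ω) ∂μ := rfl
    _ ≤ ∫ ω, (1 + t * Y ω + t ^ 2 / (2 * (1 - t * b / 3)) * Y ω ^ 2) ∂μ := integral_mono hexpi (i1.add i2) hpt
    _ = 1 + t * ∫ ω, Y ω ∂μ + t ^ 2 / (2 * (1 - t * b / 3)) * ∫ ω, Y ω ^ 2 ∂μ := by
        rw [integral_add i1 i2, integral_add (integrable_const 1) i3, integral_const_mul, integral_const_mul]
        simp
    _ ≤ 1 + t ^ 2 * v / (2 * (1 - t * b / 3)) := by
        rw [hY0, mul_zero, add_zero]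
        have : t ^ 2 / (2 * (1 - t * b / 3)) * ∫ ω, Y ω ^ 2 ∂μ ≤ t ^ 2 / (2 * (1 - t * b / 3)) * v :=
          mul_le_mul_of_nonneg_left hv (by positivity)
        have hre : t ^ 2 / (2 * (1 - t * b / 3)) * v = t ^ 2 * v / (2 * (1 - t * b / 3)) := by ring
        linarith
    _ ≤ Real.exp (t ^ 2 * v / (2 * (1 - t * b / 3))) := by
        linarith [Real.add_one_le_exp (t ^ 2 * v / (2 * (1 - t * b / 3)))]

variable {X : ℕ → Ω' → ℝ}

/-- **BERNSTEIN'S INEQUALITY** (Bernstein 1924; e.g. Boucheron–Lugosi–Massart Thm 2.10 — named, proved here): mutually independent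
measurable `X_j` with `|X_j − E X_j| ≤ b` and `Var X_j ≤ σ²` (`σ² > 0`); for `t ≥ 0` and `R ≥ 1`,
`P(Σ_{j<R}(X_j − E X_j) ≥ t) ≤ exp(−t²/(2(Rσ² + bt/3)))`. [ours — Chernoff's method with `bernstein_mgf_le` at `λ = t/(Rσ² + bt/3)`] -/
theorem bernstein_sum_ge (hXm : ∀ j, Measurable (X j)) (hind : iIndepFun X μ) {b : ℝ}
    (hbd : ∀ j ω, |X j ω - μ[X j]| ≤ b) {σ2 : ℝ} (hσ : 0 < σ2) (hvar : ∀ j, variance (X j) μ ≤ σ2)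
    {t : ℝ} (ht : 0 ≤ t) {R : ℕ} (hR : 1 ≤ R) :
    μ.real {ω | t ≤ ∑ j ∈ range R, (X j ω - μ[X j])} ≤ Real.exp (-t ^ 2 / (2 * (R * σ2 + b * t / 3))) := by
  -- `b ≥ 0` (the space is nonempty)
  obtain ⟨ω₀, -⟩ := nonempty_of_measure_ne_zero (μ := μ) (s := Set.univ) (by simp)
  have hb : 0 ≤ b := (abs_nonneg _).trans (hbd 0 ω₀)
  have hYm : ∀ j, Measurable (fun ω => X j ω - μ[X j]) := fun j => (hXm j).sub_const _
  have hindY : iIndepFun (fun j ω => X j ω - μ[X j]) μ := by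
    have h := hind.comp (fun j => fun x : ℝ => x - ∫ ω', X j ω' ∂μ) (fun j => measurable_id.sub_const _)
    exact h
  have hXi : ∀ j, Integrable (X j) μ := fun j =>
    Integrable.of_bound (hXm j).aestronglyMeasurable (b + |μ[X j]|) (ae_of_all _ fun ω => by
      rw [Real.norm_eq_abs]
      have h := abs_add_le (X j ω - μ[X j]) (μ[X j])
      rw [sub_add_cancel] at h
      linarith [hbd j ω])
  have hY0 : ∀ j, μ[fun ω => X j ω - μ[X j]] = 0 := fun j => by
    rw [integral_sub (hXi j) (integrable_const _), integral_const, smul_eq_mul, probReal_univ, one_mul, sub_self]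
  have hY2 : ∀ j, ∫ ω, (X j ω - μ[X j]) ^ 2 ∂μ ≤ σ2 := fun j => by
    have h := hvar j
    rwa [variance_eq_integral (hXm j).aemeasurable] at h
  set Y : ℕ → Ω' → ℝ := fun j ω => X j ω - μ[X j] with hY
  set V : ℝ := R * σ2 with hV
  have hRpos : (0 : ℝ) < R := Nat.cast_pos.2 (by omega)
  have hVpos : 0 < V := mul_pos hRpos hσ
  set D : ℝ := V + b * t / 3 with hD
  have hDpos : 0 < D := by positivity
  set lam : ℝ := t / D with hlam
  have hlam0 : 0 ≤ lam := div_nonneg ht hDpos.le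
  have hlamb : lam * b < 3 := by
    rw [hlam, div_mul_eq_mul_div, div_lt_iff₀ hDpos]
    nlinarith
  -- one-variable mgf bounds
  have hmgf : ∀ j, mgf (Y j) μ lam ≤ Real.exp (lam ^ 2 * σ2 / (2 * (1 - lam * b / 3))) := fun j =>
    bernstein_mgf_le (hYm j) (fun ω => hbd j ω) (hY0 j) (hY2 j) hlam0 hlamb
  -- mgf of the sum
  have hsum : mgf (∑ j ∈ range R, Y j) μ lam ≤ Real.exp (R * (lam ^ 2 * σ2 / (2 * (1 - lam * b / 3)))) := by
    rw [hindY.mgf_sum hYm (range R)]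
    calc ∏ j ∈ range R, mgf (Y j) μ lam ≤ ∏ j ∈ range R, Real.exp (lam ^ 2 * σ2 / (2 * (1 - lam * b / 3))) :=
          prod_le_prod (fun j _ => mgf_nonneg) fun j _ => hmgf j
      _ = Real.exp (R * (lam ^ 2 * σ2 / (2 * (1 - lam * b / 3)))) := by
          rw [prod_const, card_range, ← Real.exp_nat_mul]
  -- Chernoff
  have hint : Integrable (fun ω => Real.exp (lam * (∑ j ∈ range R, Y j) ω)) μ :=
    hindY.integrable_exp_mul_sum hYm fun j _ =>
      Integrable.of_bound (((hYm j).const_mul lam).exp).aestronglyMeasurable (Real.exp (lam * b)) (ae_of_all _ fun ω => by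
        rw [Real.norm_eq_abs, abs_of_pos (Real.exp_pos _), Real.exp_le_exp]
        calc lam * Y j ω ≤ lam * |Y j ω| := mul_le_mul_of_nonneg_left (le_abs_self _) hlam0
          _ ≤ lam * b := mul_le_mul_of_nonneg_left (hbd j ω) hlam0)
  have hch := measure_ge_le_exp_mul_mgf (X := ∑ j ∈ range R, Y j) (μ := μ) t hlam0 hint
  have hset : {ω | t ≤ ∑ j ∈ range R, (X j ω - μ[X j])} = {ω | t ≤ (∑ j ∈ range R, Y j) ω} := by
    ext ω; simp [hY, Finset.sum_apply]
  rw [hset]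
  refine hch.trans ?_
  calc Real.exp (-lam * t) * mgf (∑ j ∈ range R, Y j) μ lam
      ≤ Real.exp (-lam * t) * Real.exp (R * (lam ^ 2 * σ2 / (2 * (1 - lam * b / 3)))) :=
        mul_le_mul_of_nonneg_left hsum (Real.exp_pos _).le
    _ = Real.exp (-t ^ 2 / (2 * (R * σ2 + b * t / 3))) := by
        rw [← Real.exp_add]
        congr 1
        have hden : 1 - lam * b / 3 = V / D := by
          rw [hlam]; field_simp; ring
        rw [hden, hlam, ← hV, ← hD]
        field_simp
        ring

/-- **BERNSTEIN, UPPER TAIL, FOR AN AVERAGE WITH A COMMON MEAN `m`**: `P(R⁻¹Σ_{j<R} X_j − m ≥ ε) ≤ exp(−Rε²/(2(σ² + bε/3)))`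
(`ε ≥ 0`, `R ≥ 1`, `σ² > 0`). [ours] -/
theorem bernstein_avg_ge (hXm : ∀ j, Measurable (X j)) (hind : iIndepFun X μ) {b : ℝ} {m : ℝ} (hmean : ∀ j, μ[X j] = m)
    (hbd : ∀ j ω, |X j ω - m| ≤ b) {σ2 : ℝ} (hσ : 0 < σ2) (hvar : ∀ j, variance (X j) μ ≤ σ2)
    {ε : ℝ} (hε : 0 ≤ ε) {R : ℕ} (hR : 1 ≤ R) :
    μ.real {ω | ε ≤ (R : ℝ)⁻¹ * ∑ j ∈ range R, X j ω - m} ≤ Real.exp (-(R * ε ^ 2) / (2 * (σ2 + b * ε / 3))) := by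
  have hRpos : (0 : ℝ) < R := Nat.cast_pos.2 (by omega)
  have hR0 : (R : ℝ) ≠ 0 := hRpos.ne'
  have h := bernstein_sum_ge hXm hind (b := b) (fun j ω => by rw [hmean j]; exact hbd j ω) hσ hvar
    (t := R * ε) (mul_nonneg hRpos.le hε) hR
  have hset : {ω | ε ≤ (R : ℝ)⁻¹ * ∑ j ∈ range R, X j ω - m} = {ω | (R : ℝ) * ε ≤ ∑ j ∈ range R, (X j ω - μ[X j])} := by
    ext ω
    simp only [Set.mem_setOf_eq, hmean, sum_sub_distrib, sum_const, card_range, nsmul_eq_mul]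
    constructor
    · intro h0
      have h1 := mul_le_mul_of_nonneg_left h0 hRpos.le
      rwa [mul_sub, ← mul_assoc, mul_inv_cancel₀ hR0, one_mul] at h1
    · intro h0
      have h1 := mul_le_mul_of_nonneg_left h0 (inv_nonneg.2 hRpos.le)
      rwa [mul_sub, ← mul_assoc, inv_mul_cancel₀ hR0, one_mul, ← mul_assoc, inv_mul_cancel₀ hR0, one_mul] at h1
  have hexp : -((R : ℝ) * ε) ^ 2 / (2 * (R * σ2 + b * (R * ε) / 3)) = -(R * ε ^ 2) / (2 * (σ2 + b * ε / 3)) := by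
    have hd : σ2 + b * ε / 3 ≠ 0 := by
      intro h0
      -- `σ2 > 0` and, if `b < 0`, the bound `|X j ω − m| ≤ b` is vacuous only on an empty space; use `R*(σ2 + bε/3)`-free algebra
      have : (R : ℝ) * σ2 + b * (R * ε) / 3 = R * (σ2 + b * ε / 3) := by ring
      obtain ⟨ω₀, -⟩ := nonempty_of_measure_ne_zero (μ := μ) (s := Set.univ) (by simp)
      have hb : 0 ≤ b := (abs_nonneg _).trans (hbd 0 ω₀)
      nlinarith
    field_simp
  rw [hset, ← hexp]
  exact h

/-- **BERNSTEIN, LOWER TAIL, FOR AN AVERAGE**: `P(m − R⁻¹Σ_{j<R} X_j ≥ ε) ≤ exp(−Rε²/(2(σ² + bε/3)))`. [ours] -/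
theorem bernstein_avg_le (hXm : ∀ j, Measurable (X j)) (hind : iIndepFun X μ) {b : ℝ} {m : ℝ} (hmean : ∀ j, μ[X j] = m)
    (hbd : ∀ j ω, |X j ω - m| ≤ b) {σ2 : ℝ} (hσ : 0 < σ2) (hvar : ∀ j, variance (X j) μ ≤ σ2)
    {ε : ℝ} (hε : 0 ≤ ε) {R : ℕ} (hR : 1 ≤ R) :
    μ.real {ω | ε ≤ m - (R : ℝ)⁻¹ * ∑ j ∈ range R, X j ω} ≤ Real.exp (-(R * ε ^ 2) / (2 * (σ2 + b * ε / 3))) := by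
  have h := bernstein_avg_ge (X := fun j ω => -X j ω) (fun j => (hXm j).neg)
    (hind.comp (fun _ => fun x : ℝ => -x) fun _ => measurable_neg) (b := b) (m := -m)
    (fun j => by rw [integral_neg, hmean j]) (fun j ω => by rw [show -X j ω - -m = -(X j ω - m) by ring, abs_neg]; exact hbd j ω)
    hσ (fun j => by rw [show (fun ω => -X j ω) = -X j from rfl, variance_neg]; exact hvar j) hε hR
  have hset : {ω | ε ≤ m - (R : ℝ)⁻¹ * ∑ j ∈ range R, X j ω} = {ω | ε ≤ (R : ℝ)⁻¹ * ∑ j ∈ range R, -X j ω - -m} := by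
    ext ω
    simp only [Set.mem_setOf_eq, sum_neg_distrib, mul_neg, sub_neg_eq_add]
    rw [neg_add_eq_sub]
  rw [hset]
  exact h

/-- **BERNSTEIN, TWO-SIDED, FOR AN AVERAGE**: `P(|R⁻¹Σ_{j<R} X_j − m| ≥ ε) ≤ 2·exp(−Rε²/(2(σ² + bε/3)))`. [ours] -/
theorem bernstein_avg_abs (hXm : ∀ j, Measurable (X j)) (hind : iIndepFun X μ) {b : ℝ} {m : ℝ} (hmean : ∀ j, μ[X j] = m)
    (hbd : ∀ j ω, |X j ω - m| ≤ b) {σ2 : ℝ} (hσ : 0 < σ2) (hvar : ∀ j, variance (X j) μ ≤ σ2)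
    {ε : ℝ} (hε : 0 ≤ ε) {R : ℕ} (hR : 1 ≤ R) :
    μ.real {ω | ε ≤ |(R : ℝ)⁻¹ * ∑ j ∈ range R, X j ω - m|} ≤ 2 * Real.exp (-(R * ε ^ 2) / (2 * (σ2 + b * ε / 3))) := by
  have h1 := bernstein_avg_ge hXm hind hmean hbd hσ hvar hε hR
  have h2 := bernstein_avg_le hXm hind hmean hbd hσ hvar hε hR
  have hsub : {ω | ε ≤ |(R : ℝ)⁻¹ * ∑ j ∈ range R, X j ω - m|} ⊆
      {ω | ε ≤ (R : ℝ)⁻¹ * ∑ j ∈ range R, X j ω - m} ∪ {ω | ε ≤ m - (R : ℝ)⁻¹ * ∑ j ∈ range R, X j ω} := by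
    intro ω hω
    simp only [Set.mem_setOf_eq, Set.mem_union] at hω ⊢
    rcases le_abs'.1 hω with h | h
    · right; linarith
    · left; exact h
  calc μ.real {ω | ε ≤ |(R : ℝ)⁻¹ * ∑ j ∈ range R, X j ω - m|}
      ≤ μ.real ({ω | ε ≤ (R : ℝ)⁻¹ * ∑ j ∈ range R, X j ω - m} ∪ {ω | ε ≤ m - (R : ℝ)⁻¹ * ∑ j ∈ range R, X j ω}) :=
        measureReal_mono hsub
    _ ≤ μ.real {ω | ε ≤ (R : ℝ)⁻¹ * ∑ j ∈ range R, X j ω - m} + μ.real {ω | ε ≤ m - (R : ℝ)⁻¹ * ∑ j ∈ range R, X j ω} :=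
        measureReal_union_le _ _
    _ ≤ 2 * Real.exp (-(R * ε ^ 2) / (2 * (σ2 + b * ε / 3))) := by linarith

end Generic

end Summit.Ventures.LatticeQCDFlow.Exactness

end
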